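import Summits.Ventures.HodgeRepro2.T5LevelIdempotent

/-!
# A diagonally invariant pairing does not see the `K`-average on a `K`-fixed vector

Kernel annex of the Tier-5 record (blind lane).  The `K`-average step of N3.L7 reads:
for `u` a `K`-fixed vector, `Θ(u, e_K φ) = ∫_K Θ(u, ω(k) φ) dk = ∫_K Θ(R(k^{∓1}) u, φ) dk = Θ(u, φ)`,
where `Θ(f, φ)` is invariant under the diagonal action of `K` (`Θ(R(k) f, ω(k) φ) = Θ(f, φ)`,
N3.L3).  In the Haar-measure-free form of `T5LevelIdempotent` (`e_K w = levelAverage ω K w`,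
a finite average over `K / K_w`) this is:

* `pairing_apply_of_mem_invariants` — `B(u, ω(κ) w) = B(u, w)` for `κ ∈ K` and `u ∈ U^K`;
* `pairing_cosetSum` — `B(u, Σ_{c ∈ K/H} ω(c) w) = [K : H] • B(u, w)`;
* `pairing_levelAverage` — `B(u, e_K w) = B(u, w)` (char `0`, `[K : K_w] < ∞`), and
  `pairing_levelIdempotent` for the projector `levelIdempotent` of `T5LevelIdempotent`.

`B : U → W →ₗ[k] X` is any map, `k`-linear in the second variable only (so the statement covers the
antilinear-in-`f` lift `Θ(f, φ)` of the record as well as bilinear pairings), with the diagonal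
invariance `hB : ∀ g u w, B (ρ g u) (ω g w) = B u w`.  What stays prose: that the lift of the
record is diagonally invariant (N3.L3, from the definition of the theta kernel) and that its
`K`-average is the Haar average (`T5LevelIdempotentFinite` / `T5HaarHeckeAction` supply the
dictionary); the printed theorems.
-/

namespace Summit.Ventures.HodgeRepro2.T5DiagonalInvariantAverage

open T5LevelIdempotent LevelPositivity

variable {G : Type*} [Group G] {k : Type*} [Field k]
  {U : Type*} [AddCommGroup U] [Module k U] {W : Type*} [AddCommGroup W] [Module k W]
  {X : Type*} [AddCommGroup X] [Module k X]
  (ρ : Representation k G U) (ω : Representation k G W) {K : Subgroup G}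
  (B : U → W →ₗ[k] X) (hB : ∀ (g : G) (u : U) (w : W), B (ρ g u) (ω g w) = B u w)

include hB

/-- For `u ∈ U^K` and `κ ∈ K`: `B(u, ω(κ) w) = B(ρ(κ) u, ω(κ) w) = B(u, w)`. -/
theorem pairing_apply_of_mem_invariants {u : U} (hu : u ∈ invariants ρ K) {κ : G} (hκ : κ ∈ K)
    (w : W) : B u (ω κ w) = B u w := by
  have h := hB κ u w
  rwa [mem_invariants_iff.1 hu κ hκ] at h

/-- `B(u, Σ_{c ∈ K/H} ω(c) w) = [K : H] • B(u, w)` for `u ∈ U^K` and `H ≤ K` of finite index. -/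
theorem pairing_cosetSum {u : U} (hu : u ∈ invariants ρ K) (H : Subgroup K) [H.FiniteIndex]
    (w : W) : B u (cosetSum ω H w) = H.index • B u w := by
  have hfin : Finite (K ⧸ H) := Subgroup.finite_quotient_of_finiteIndex
  unfold cosetSum
  rw [map_finsum (B u) (Set.toFinite _)]
  have : ∀ c : K ⧸ H, B u (ω ((Quotient.out c : K) : G) w) = B u w := fun c =>
    pairing_apply_of_mem_invariants ρ ω B hB hu (Quotient.out c).2 w
  simp only [this]
  haveI := Fintype.ofFinite (K ⧸ H)
  rw [finsum_eq_sum_of_fintype, Finset.sum_const, Finset.card_univ, Subgroup.index_eq_card,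
    Nat.card_eq_fintype_card]

/-- **The `K`-average is invisible to a diagonally invariant pairing on a `K`-fixed vector**:
`B(u, e_K w) = B(u, w)` for `u ∈ U^K` (char `0`, `[K : K_w] < ∞`). -/
theorem pairing_levelAverage [CharZero k] {u : U} (hu : u ∈ invariants ρ K) (w : W)
    [(stabilizerIn ω K w).FiniteIndex] : B u (levelAverage ω K w) = B u w := by
  unfold levelAverage
  rw [map_smul, pairing_cosetSum ρ ω B hB hu, ← Nat.cast_smul_eq_nsmul k, smul_smul,
    inv_mul_cancel₀, one_smul]
  exact_mod_cast Subgroup.FiniteIndex.index_ne_zero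

/-- The same for the projector `levelIdempotent K h : W →ₗ[k] W` (`ω` `K`-finite, char `0`). -/
theorem pairing_levelIdempotent [CharZero k] (h : KFinite ω K) {u : U} (hu : u ∈ invariants ρ K)
    (w : W) : B u (levelIdempotent K h w) = B u w := by
  haveI : (stabilizerIn ω K w).FiniteIndex := h w
  rw [levelIdempotent_apply, pairing_levelAverage ρ ω B hB hu w]

/-- Consequently `B(u, ·)` vanishes on all of `W` as soon as it vanishes on the `K`-fixed vectors
`e_K w` — the contrapositive used in N3.L7 («if `Θ(u, φ_f′) = 0` for all `K`-fixed `φ_f′` then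
`Θ(u, φ_f) = 0` for ALL `φ_f`»). -/
theorem pairing_eq_zero_of_forall_invariants_eq_zero [CharZero k] (h : KFinite ω K) {u : U}
    (hu : u ∈ invariants ρ K)
    (h0 : ∀ w' : W, w' ∈ invariants ω K → B u w' = 0) (w : W) : B u w = 0 := by
  haveI : (stabilizerIn ω K w).FiniteIndex := h w
  rw [← pairing_levelAverage ρ ω B hB hu w]
  exact h0 _ levelAverage_mem_invariants

end Summit.Ventures.HodgeRepro2.T5DiagonalInvariantAverage
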